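import Literature.AlgebraicTopology.FundamentalGroup.FreeGroupPuncturedPlane
import Mathlib.Topology.Homotopy.Lifting
import HarnessLib

/-!
# Lassos around the punctures of a planar domain

Topic `Literature/AlgebraicTopology/FundamentalGroup`.  Companion of `FreeGroupPuncturedPlane`
(`π₁(C ∖ F) ≅ F(Fin |F|)` for `C ⊆ ℂ` convex open and `F ⊆ C` finite, where "an explicit basis of
loops around the punctures is not extracted").  This file introduces the explicit loops — the
**lassos** (Hatcher's loops "going once around" a puncture; Shimada's lassos `η⁻¹ · ∂δ · η` of
leashed discs, planar case) — and proves their elementary loop calculus: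

* `PlanarLasso Y x a` — for a planar region `Y ⊆ ℂ`, a base point `x ∈ Y` and a centre `a`: a
  radius `ε > 0` such that the closed punctured disc `{a + c | 0 < |c| ≤ ε}` lies in `Y`, and a
  leash, a path in `Y` from `x` to `a + ε`; its loop `leash · circle · leash⁻¹`
  (`PlanarLasso.loop`, circle `θ ↦ a + ε e^{2πiθ}`) and class `PlanarLasso.loopClass ∈ π₁(Y, x)`;
* `Square.mk_trans_eq` — the square lemma: for a continuous `F : I × I → X`,
  `[left edge] · [top edge] = [bottom edge] · [right edge]` in the fundamental groupoid
  (Hatcher, Lemma 1.19, the form used here);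
* `PlanarLasso.isConj_loopClass` — **two lassos around the same centre are conjugate** in
  `π₁(Y, x)` (annulus homotopy between the two circles, then leash calculus);
* transport: along an inclusion `Y ⊆ Y'` (`PlanarLasso.incl`, `mapOfEq_loopClass`) and along a
  change of base point (`PlanarLasso.precomp`, `pathConj_loopClass`);

The generation theorems (`π₁(C ∖ {a}, x)` is generated by the class of any lasso; `π₁(C ∖ F, x)`
is the normal closure of the lasso classes for `F` finite) are in
`PuncturedPlaneLassoGenerators.lean`.  Everything here is proved; no named facts.

## References

* A. Hatcher, *Algebraic Topology*, CUP (2002), §1.1 Prop. 1.5 (change of base point),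
  Lemma 1.19 (free homotopies conjugate), Thm. 1.7 and §1.3 (coverings). [HatcherAT2002]
* I. Shimada, *Generalized Zariski–van Kampen theorem and its application to Grassmannian dual
  varieties*, Int. J. Math. 21 (2010), §3 (lassos of leashed discs). [Shimada2010ZvK]

## Design notes

* `_root_.FundamentalGroup` is written in full (the directory name shadows Mathlib's namespace
  inside `Literature.AlgebraicTopology.FundamentalGroup`, CONVENTIONS.md §2).
* The circle is parametrised as `a + ε · exp (2π i θ)`, the parametrisation of the meridians of
  `Literature/AlgebraicGeometry/FundamentalGroup/HypersurfaceComplementMeridians` read in a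
  complex line.
* No declaration in this file uses `sorry`.
-/

noncomputable section

open Set Function unitInterval Topology Complex

namespace Literature.AlgebraicTopology.FundamentalGroup

/-! ### The square lemma -/

section Square

variable {X : Type*} [TopologicalSpace X]

/-- The identity path of the unit interval, from `0` to `1`. [folklore] -/
def Square.diag : Path (0 : I) 1 where
  toFun := id
  continuous_toFun := continuous_id
  source' := rfl
  target' := rfl

/-- **Square lemma.** For a continuous map `F : I × I → X` with bottom edge `F(t, 0) = b(t)`,
top edge `F(t, 1) = τ(t)`, left edge `F(0, θ) = l(θ)` and right edge `F(1, θ) = r(θ)`: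
`[l] · [τ] = [b] · [r]` in the fundamental groupoid (the two edge paths of the simply connected
square from `(0, 0)` to `(1, 1)` are homotopic; push forward along `F`).  Hatcher's Lemma 1.19
("a free homotopy conjugates by the track of the base point") is the case `b = τ`.
[cite: HatcherAT2002, §1.1 Lemma 1.19] -/
theorem Square.mk_trans_eq (F : C(I × I, X)) {p₀₀ p₁₀ p₀₁ p₁₁ : X} (b : Path p₀₀ p₁₀)
    (τ : Path p₀₁ p₁₁) (l : Path p₀₀ p₀₁) (r : Path p₁₀ p₁₁) (hb : ∀ t, F (t, 0) = b t)
    (hτ : ∀ t, F (t, 1) = τ t) (hl : ∀ θ, F (0, θ) = l θ) (hr : ∀ θ, F (1, θ) = r θ) :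
    (Path.Homotopic.Quotient.mk l).trans (Path.Homotopic.Quotient.mk τ) =
      (Path.Homotopic.Quotient.mk b).trans (Path.Homotopic.Quotient.mk r) := by
  haveI : ContractibleSpace I :=
    (convex_Icc (0 : ℝ) 1).contractibleSpace ⟨0, Set.left_mem_Icc.2 zero_le_one⟩
  let L : Path ((0 : I), (0 : I)) (0, 1) := (Path.refl (0 : I)).prod Square.diag
  let T : Path ((0 : I), (1 : I)) (1, 1) := Square.diag.prod (Path.refl (1 : I))
  let B : Path ((0 : I), (0 : I)) (1, 0) := Square.diag.prod (Path.refl (0 : I))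
  let R : Path ((1 : I), (0 : I)) (1, 1) := (Path.refl (1 : I)).prod Square.diag
  have hsq : (L.trans T).Homotopic (B.trans R) := SimplyConnectedSpace.paths_homotopic _ _
  have hF := Path.Homotopic.Quotient.eq.mpr (hsq.map F)
  rw [Path.map_trans, Path.map_trans, Path.Homotopic.Quotient.mk_trans,
    Path.Homotopic.Quotient.mk_trans] at hF
  have e₀₀ : p₀₀ = F (0, 0) := by rw [hb]; exact b.source.symm
  have e₁₀ : p₁₀ = F (1, 0) := by rw [hb]; exact b.target.symm
  have e₀₁ : p₀₁ = F (0, 1) := by rw [hτ]; exact τ.source.symm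
  have e₁₁ : p₁₁ = F (1, 1) := by rw [hτ]; exact τ.target.symm
  subst e₀₀ e₁₀ e₀₁ e₁₁
  have eL : L.map F.continuous = l := by ext θ; simp [L, Square.diag, hl]
  have eT : T.map F.continuous = τ := by ext t; simp [T, Square.diag, hτ]
  have eB : B.map F.continuous = b := by ext t; simp [B, Square.diag, hb]
  have eR : R.map F.continuous = r := by ext θ; simp [R, Square.diag, hr]
  rw [eL, eT, eB, eR] at hF
  exact hF

/-- **Conjugacy of lassos from a conjugation of circles** (Hatcher, Prop. 1.5 with Lemma 1.19):
if loops `c₀` at `e₀` and `c₁` at `e₁` satisfy `[c₀] · [α] = [α] · [c₁]` for a path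
`α : e₀ ⇝ e₁`, then for any two leashes `l₀ : s ⇝ e₀`, `l₁ : s ⇝ e₁` the lassos
`l₀ · c₀ · l₀⁻¹` and `l₁ · c₁ · l₁⁻¹` are conjugate in `π₁(X, s)`. [cite: HatcherAT2002, §1.1 Prop. 1.5 and Lemma 1.19] -/
theorem Square.isConj_lasso {s e₀ e₁ : X} (c₀ : Path e₀ e₀) (c₁ : Path e₁ e₁) (α : Path e₀ e₁)
    (h : (Path.Homotopic.Quotient.mk c₀).trans (Path.Homotopic.Quotient.mk α) =
      (Path.Homotopic.Quotient.mk α).trans (Path.Homotopic.Quotient.mk c₁))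
    (l₀ : Path s e₀) (l₁ : Path s e₁) :
    IsConj (FundamentalGroup.fromPath (Path.Homotopic.Quotient.mk ((l₀.trans c₀).trans l₀.symm)))
      (FundamentalGroup.fromPath (Path.Homotopic.Quotient.mk ((l₁.trans c₁).trans l₁.symm))) := by
  -- `[c₀] = [α] [c₁] [α]⁻¹`
  have h' : Path.Homotopic.Quotient.mk c₀ = (Path.Homotopic.Quotient.mk α).trans
      ((Path.Homotopic.Quotient.mk c₁).trans (Path.Homotopic.Quotient.mk α).symm) := by
    rw [← Path.Homotopic.Quotient.trans_assoc, ← h, Path.Homotopic.Quotient.trans_assoc,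
      Path.Homotopic.Quotient.trans_symm, Path.Homotopic.Quotient.trans_refl]
  refine isConj_iff.mpr ⟨FundamentalGroup.fromPath
    ((Path.Homotopic.Quotient.mk l₀).trans
      ((Path.Homotopic.Quotient.mk α).trans (Path.Homotopic.Quotient.mk l₁).symm)), ?_⟩
  rw [FundamentalGroup.mul_def, FundamentalGroup.mul_def, FundamentalGroup.inv_def]
  simp only [FundamentalGroup.fromPath, FundamentalGroup.fromArrow,
    Path.Homotopic.Quotient.mk_trans, Path.Homotopic.Quotient.mk_symm, h']
  have hsymm : ∀ {a b c : X} (p : Path.Homotopic.Quotient a b) (q : Path.Homotopic.Quotient b c),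
      (p.trans q).symm = q.symm.trans p.symm := by
    intro a b c p q
    induction p using Path.Homotopic.Quotient.ind with | mk p =>
    induction q using Path.Homotopic.Quotient.ind with | mk q =>
    rw [← Path.Homotopic.Quotient.mk_trans, ← Path.Homotopic.Quotient.mk_symm, Path.trans_symm,
      Path.Homotopic.Quotient.mk_trans, Path.Homotopic.Quotient.mk_symm,
      Path.Homotopic.Quotient.mk_symm]
  have hss : ∀ {a b : X} (p : Path.Homotopic.Quotient a b), p.symm.symm = p := by
    intro a b p
    induction p using Path.Homotopic.Quotient.ind with | mk p =>
    rw [← Path.Homotopic.Quotient.mk_symm, ← Path.Homotopic.Quotient.mk_symm, Path.symm_symm]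
  have hc1 : ∀ {a b c : X} (p : Path.Homotopic.Quotient a b) (q : Path.Homotopic.Quotient b c),
      p.symm.trans (p.trans q) = q := by
    intro a b c p q
    rw [← Path.Homotopic.Quotient.trans_assoc, Path.Homotopic.Quotient.symm_trans,
      Path.Homotopic.Quotient.refl_trans]
  simp only [hsymm, hss, Path.Homotopic.Quotient.trans_assoc, hc1]

end Square

/-! ### Lassos -/

/-- The point `a + ε e^{2πiθ}` of the circle of radius `ε` about `a`. [folklore] -/
def circlePt (a : ℂ) (ε : ℝ) (θ : I) : ℂ :=
  a + (ε : ℂ) * Complex.exp (2 * Real.pi * Complex.I * ((θ : ℝ) : ℂ))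

/-- `|e^{2πiθ}| = 1`. [folklore] -/
private theorem norm_exp_two_pi_mul_I_mul (θ : ℝ) :
    ‖Complex.exp (2 * Real.pi * Complex.I * (θ : ℂ))‖ = 1 := by
  rw [Complex.norm_exp]
  have hre : (2 * (Real.pi : ℂ) * Complex.I * (θ : ℂ)).re = 0 := by simp [Complex.mul_re]
  rw [hre, Real.exp_zero]

/-- `a + ε e^{0} = a + ε`. [folklore] -/
@[simp] private theorem circlePt_zero (a : ℂ) (ε : ℝ) : circlePt a ε 0 = a + ε := by simp [circlePt]

/-- `a + ε e^{2πi} = a + ε`. [folklore] -/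
@[simp] private theorem circlePt_one (a : ℂ) (ε : ℝ) : circlePt a ε 1 = a + ε := by simp [circlePt]

/-- The circle is continuous in `θ`. [folklore] -/
private theorem continuous_circlePt (a : ℂ) (ε : ℝ) : Continuous (circlePt a ε) := by
  unfold circlePt; fun_prop

/-- A **lasso** of the planar region `Y ⊆ ℂ` around the centre `a`, based at `x ∈ Y`: a radius
`ε > 0` such that the closed punctured disc `{a + c | 0 < |c| ≤ ε}` lies in `Y`, and a leash — a
path in `Y` from `x` to the point `a + ε` of the circle (Shimada's leashed disc `(δ, η)` with
`δ(c) = a + ε c`, planar case; Hatcher's loop "going once around" `a`).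
[cite: Shimada2010ZvK, §3 (leashed discs and lassos)] -/
structure PlanarLasso (Y : Set ℂ) (x : Y) (a : ℂ) where
  /-- The radius of the circle. -/
  ε : ℝ
  ε_pos : 0 < ε
  /-- The closed punctured disc of radius `ε` about `a` lies in `Y`. -/
  mem : ∀ c : ℂ, c ≠ 0 → ‖c‖ ≤ ε → a + c ∈ Y
  /-- `a + ε ∈ Y` (forced by `mem`; recorded so that the type of `leash` is a closed term). -/
  leashEnd_mem : a + (ε : ℂ) ∈ Y
  /-- The leash: a path in `Y` from the base point to `a + ε`. -/
  leash : Path x ⟨a + (ε : ℂ), leashEnd_mem⟩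

namespace PlanarLasso

variable {Y : Set ℂ} {x : Y} {a : ℂ} (L : PlanarLasso Y x a)

/-- The start `a + ε` of the circle, as a point of `Y` (reducible, so that the endpoint types
`leashEnd` and `⟨a + ε, _⟩` of the paths below unify syntactically). [folklore] -/
abbrev leashEnd : Y := ⟨a + (L.ε : ℂ), L.leashEnd_mem⟩

/-- `leashEnd` is `a + ε`. [folklore] -/
@[simp] private theorem coe_leashEnd : (L.leashEnd : ℂ) = a + (L.ε : ℂ) := rfl

/-- The circle `∂δ` of the lasso lies in `Y` (the punctured disc does).
[cite: Shimada2010ZvK, §3 (Definition of the lasso: `∂δ` is a loop of `M ∖ H`)] -/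
theorem circlePt_mem (θ : I) : circlePt a L.ε θ ∈ Y := by
  refine L.mem _ (mul_ne_zero (by exact_mod_cast L.ε_pos.ne') (Complex.exp_ne_zero _)) ?_
  rw [norm_mul, norm_exp_two_pi_mul_I_mul, mul_one]
  simp [abs_of_pos L.ε_pos]

/-- The circle `θ ↦ a + ε e^{2πiθ}` of the lasso, a loop of `Y` at `a + ε`. [folklore] -/
def circle : Path L.leashEnd L.leashEnd where
  toFun θ := ⟨circlePt a L.ε θ, L.circlePt_mem θ⟩
  continuous_toFun := (continuous_circlePt a L.ε).subtype_mk _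
  source' := Subtype.ext (by simp)
  target' := Subtype.ext (by simp)

/-- Values of the circle: `∂δ(θ) = a + ε e^{2πiθ}`.
[cite: Shimada2010ZvK, §3 (Definition: `∂δ` is the loop `t ↦ δ(exp 2π√-1 t)`)] -/
@[simp] theorem coe_circle_apply (θ : I) : (L.circle θ : ℂ) = circlePt a L.ε θ := rfl

/-- The loop `leash · circle · leash⁻¹` of the lasso, based at `x`. [cite: Shimada2010ZvK, §3 (the lasso `λ(ρ)`)] -/
def loop : Path x x := (L.leash.trans L.circle).trans L.leash.symm

/-- The class of the lasso in `π₁(Y, x)`. [cite: Shimada2010ZvK, §3 (the lasso `λ(ρ)`)] -/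
def loopClass : _root_.FundamentalGroup Y x :=
  FundamentalGroup.fromPath (Path.Homotopic.Quotient.mk L.loop)

/-! ### Two lassos around the same centre are conjugate -/

/-- **Two lassos of `Y` around the same centre, at the same base point, are conjugate in
`π₁(Y, x)`**: the circles of radii `ε₀`, `ε₁` are the ends of the annulus homotopy
`(t, θ) ↦ a + ((1-t)ε₀ + tε₁) e^{2πiθ}` inside the larger punctured disc, so
`[c₀] · [α] = [α] · [c₁]` for the radial track `α`, and the leashes only conjugate
(`Square.isConj_lasso`). [cite: HatcherAT2002, §1.1 Prop. 1.5 and Lemma 1.19] -/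
theorem isConj_loopClass (L L' : PlanarLasso Y x a) : IsConj L.loopClass L'.loopClass := by
  -- the radius at time `t`
  let ρ : I → ℝ := fun t => (1 - (t : ℝ)) * L.ε + (t : ℝ) * L'.ε
  have hρ_pos : ∀ t, 0 < ρ t := by
    intro t
    rcases eq_or_lt_of_le t.2.1 with h0 | h0
    · simp only [ρ, ← h0, sub_zero, one_mul, zero_mul, add_zero]; exact L.ε_pos
    · exact add_pos_of_nonneg_of_pos (mul_nonneg (sub_nonneg.2 t.2.2) L.ε_pos.le)
        (mul_pos h0 L'.ε_pos)
  have hρ_le : ∀ t, ρ t ≤ max L.ε L'.ε := by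
    intro t
    have h1 : (1 - (t : ℝ)) * L.ε ≤ (1 - (t : ℝ)) * max L.ε L'.ε :=
      mul_le_mul_of_nonneg_left (le_max_left _ _) (sub_nonneg.2 t.2.2)
    have h2 : (t : ℝ) * L'.ε ≤ (t : ℝ) * max L.ε L'.ε :=
      mul_le_mul_of_nonneg_left (le_max_right _ _) t.2.1
    calc ρ t ≤ (1 - (t : ℝ)) * max L.ε L'.ε + (t : ℝ) * max L.ε L'.ε := add_le_add h1 h2
      _ = max L.ε L'.ε := by ring
  -- the whole closed punctured disc of the larger radius lies in `Y`
  have hmem : ∀ c : ℂ, c ≠ 0 → ‖c‖ ≤ max L.ε L'.ε → a + c ∈ Y := by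
    intro c hc hle
    rcases le_total L.ε L'.ε with h | h
    · exact L'.mem c hc (by rwa [max_eq_right h] at hle)
    · exact L.mem c hc (by rwa [max_eq_left h] at hle)
  have hpt : ∀ (t θ : I), circlePt a (ρ t) θ ∈ Y := by
    intro t θ
    rw [circlePt]
    refine hmem _ (mul_ne_zero (by exact_mod_cast (hρ_pos t).ne') (Complex.exp_ne_zero _)) ?_
    rw [norm_mul, norm_exp_two_pi_mul_I_mul, mul_one, Complex.norm_real, Real.norm_eq_abs,
      abs_of_pos (hρ_pos t)]
    exact hρ_le t
  let F : C(I × I, Y) := ⟨fun q => ⟨circlePt a (ρ q.1) q.2, hpt q.1 q.2⟩, by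
    refine Continuous.subtype_mk ?_ _
    unfold circlePt
    fun_prop⟩
  -- the radial track from `a + ε₀` to `a + ε₁`
  have hρ0 : ρ 0 = L.ε := by simp [ρ]
  have hρ1 : ρ 1 = L'.ε := by simp [ρ]
  let α : Path L.leashEnd L'.leashEnd :=
    { toFun := fun t => ⟨a + (ρ t : ℂ), by simpa using hpt t 0⟩
      continuous_toFun := by
        refine Continuous.subtype_mk ?_ _
        fun_prop
      source' := Subtype.ext (by simp [hρ0])
      target' := Subtype.ext (by simp [hρ1]) }
  have hsq := Square.mk_trans_eq F α α L.circle L'.circle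
    (fun t => Subtype.ext (by simp [F, α])) (fun t => Subtype.ext (by simp [F, α]))
    (fun θ => Subtype.ext (by simp [F, hρ0])) (fun θ => Subtype.ext (by simp [F, hρ1]))
  exact Square.isConj_lasso L.circle L'.circle α hsq L.leash L'.leash

/-! ### Transport along inclusions and changes of base point -/

variable {Y' : Set ℂ}

/-- A lasso of `Y` is a lasso of any larger region `Y' ⊇ Y` (same centre, radius and leash).
[folklore] -/
def incl (h : Y ⊆ Y') (L : PlanarLasso Y x a) : PlanarLasso Y' ⟨x, h x.2⟩ a where
  ε := L.ε
  ε_pos := L.ε_pos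
  mem c hc hle := h (L.mem c hc hle)
  leashEnd_mem := h L.leashEnd_mem
  leash := L.leash.map (continuous_inclusion h)

/-- Pointwise congruence of the product of paths `p · q` across endpoint types (the product
path is defined by the same formula whatever the endpoints). [cite: HatcherAT2002, §1.1 (product of paths, p. 26)] -/
theorem trans_apply_congr {X : Type*} [TopologicalSpace X] {a b c a' b' c' : X} (p : Path a b)
    (q : Path b c) (p' : Path a' b') (q' : Path b' c') (hp : ∀ t, p t = p' t)
    (hq : ∀ t, q t = q' t) (t : I) : (p.trans q) t = (p'.trans q') t := by
  rw [Path.trans_apply, Path.trans_apply]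
  split_ifs <;> simp [hp, hq]

/-- The loop of the transported lasso is the old loop, read in `Y'`. [folklore] -/
private theorem incl_loop_apply (h : Y ⊆ Y') (θ : I) :
    (L.incl h).loop θ = Set.inclusion h (L.loop θ) := by
  have e : (L.loop.map (continuous_inclusion h)) θ = Set.inclusion h (L.loop θ) := rfl
  rw [← e, loop, loop, Path.map_trans, Path.map_trans, ← Path.map_symm]
  exact trans_apply_congr _ _ _ _ (trans_apply_congr _ _ _ _ (fun t => rfl) (fun t => rfl))
    (fun t => rfl) θ

/-- **Transport along an inclusion**: `i_* [L] = [L.incl]` for the homomorphism `i_*` induced by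
the inclusion `i : Y ↪ Y'`. [cite: HatcherAT2002, §1.1 (induced homomorphisms, p. 34)] -/
theorem mapOfEq_loopClass (h : Y ⊆ Y') :
    FundamentalGroup.mapOfEq (⟨Set.inclusion h, continuous_inclusion h⟩ : C(Y, Y')) rfl L.loopClass =
      (L.incl h).loopClass := by
  rw [loopClass, FundamentalGroup.mapOfEq_apply]
  change FundamentalGroup.fromPath (Path.Homotopic.Quotient.mk _) =
    FundamentalGroup.fromPath (Path.Homotopic.Quotient.mk _)
  congr 2
  ext θ
  exact congrArg Subtype.val (L.incl_loop_apply h θ).symm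

variable {x' : Y}

/-- Prepending a path `x' ⇝ x` to the leash moves the base point of a lasso. [folklore] -/
def precomp (p : Path x' x) (L : PlanarLasso Y x a) : PlanarLasso Y x' a where
  ε := L.ε
  ε_pos := L.ε_pos
  mem := L.mem
  leashEnd_mem := L.leashEnd_mem
  leash := p.trans L.leash

/-- **Change of base point**: the transport `c ↦ [p · c · p⁻¹]` along `p : x' ⇝ x` (Mathlib's
`(fundamentalGroupMulEquivOfPath p).symm`) sends the class of a lasso to the class of the lasso
with the prepended leash. [cite: HatcherAT2002, §1.1 Prop. 1.5] -/
theorem pathConj_loopClass (p : Path x' x) :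
    (FundamentalGroup.fundamentalGroupMulEquivOfPath p).symm L.loopClass = (L.precomp p).loopClass := by
  change FundamentalGroup.fromPath (Path.Homotopic.Quotient.mk (p.trans (L.loop.trans p.symm))) =
    FundamentalGroup.fromPath (Path.Homotopic.Quotient.mk
      (((p.trans L.leash).trans L.circle).trans (p.trans L.leash).symm))
  rw [loop, Path.trans_symm]
  simp only [Path.Homotopic.Quotient.mk_trans, Path.Homotopic.Quotient.mk_symm,
    Path.Homotopic.Quotient.trans_assoc]

end PlanarLasso

end Literature.AlgebraicTopology.FundamentalGroup
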